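import Summits.QuantumFields.YangMills.Theorems.BalabanUVNodesK0AxJoinResidualBoxSchemeNatural

/-!
# P3 g92 №22 — (R-Uk) IS ONLY NEEDED AT THE RECORD's PROVED PROP. 8 LETTERS: (R-Uk⁸) ⟸ (R-Uk), and the box-road doors re-cut on (R-Uk⁸) — LENS P3 «weaken the target»

LANDING NOTE (porter ▶ PTC-1 g4, 2026-08-31; AUTHORSHIP = ★ P3 g92 «weaken the target», HOME sketch `nodeO-cover/P3-BoxRoadUkAtProp8-v1.lean` sha16 168255ff7d18cf25 · 309 l. · 4 thm, no def, 0
sorry (№22: OBSERVATION (E) read off the kernel-checked JOIN ✓`K0AxJoinResidualBox.joinAntecedentsRadiusFirst_of_residual` — (R-Uk) is consumed at ONE tuple only, the letters of the PROVED stub-1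
text ✓`K0Stub1BHolds.prop8StepCoPGridGBAt_holds F`; hence the weaker letter (R-Uk⁸) «[15] Thm 1's U_k clause demanded only where [15] Prop. 8's grid-guarded top step holds»,
`residualUk8_of_residualUk` (R-Uk) ⟹ (R-Uk⁸), the JOIN re-proved letters-first `joinAntecedentsRadiusFirst_of_uk8_residual`, and the two box-road doors re-cut on ⁸ ∧ (R-Uk⁸) ∧ (R-Old) ∧
(R-Sch♮))): landed VERBATIM + this paragraph under P3's basename (`…Theorems/BalabanUVNodesK0AxJoinResidualBoxUk8.lean`, ns `…Theorems.K0AxJoinResidualBoxUk8`) as INTENT-81; one import ✓p826169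
`…K0AxJoinResidualBoxSchemeNatural`; `--supports stmt-QuantumFields-27238 --as helper` (NO `--workitem`; kind proof); ◆ CRIT-1 g38's cut: «(2) CUT №22 `nodeO-cover/P3-BoxRoadUkAtProp8-v1.lean`
168255ff7d18cf25 · 309 · 4 thm · 0 def∕instance∕notation∕sorry → GO VERBATIM to `…/Theorems/BalabanUVNodesK0AxJoinResidualBoxUk8.lean`, kind proof, `--supports stmt-QuantumFields-27238 --as
helper`; probe `g38/N22_probe.lean` (file + 4 std guards) rc 0 · 0 err · 0 warn · 0 sorry (audit support 1 · proof.conditional 1 · orphan 2); J4 names 0∕4 tree-wide, target absent, stmt-dedup `∃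
aU : ℝ, 0 < aU ∧ ∀ a₀` 0 files; J1′ on (R-Uk⁸) :139–:160: `aU` may depend on the Prop-8 letters (print allows it: Thm 1's radius is a function of the constants) and the antecedent is NOT a vacuity
lever in use because the JOIN :84 consumes it exactly at the PROVED stub-1 letters ✓`K0Stub1BHolds.prop8StepCoPGridGBAt_holds F`; `residualUk8_of_residualUk` records (R-Uk) ⟹ (R-Uk⁸) (a weakening;
converse not claimed); doors :164∕:229 = ✓№20∕№21 compositions re-keyed, K0ᴬ BY NAME and `hβc` VERBATIM; J5′ none; SAME-WALL: bookkeeping re-cut of a displayed letter (S), the wall (R-Uk⁸) itself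
= [15] Thm 1 (8)–(9) OPEN — SURVIVES as a door, located-A the weaker key, located-B unchanged» (nodeO STATUS 2026-08-31T15:10:09Z). HONEST (porter): a weakening of one displayed letter + a
re-ordered composition + re-keyed CONDITIONAL doors (credit nothing); (R-Uk⁸)∕(R-Old)∕(R-Sch♮) and ⁸'s box texts are OPEN Bałaban-strength content inhabited NOWHERE; nothing of Bałaban asserted,
ported, discharged or refuted; K0ᴬ stmt-QuantumFields-27238 ∕ K1ᴬ 27239 OPEN — NOTHING of them proved; NODE O 0∕1; COUNT 8∕28 · K 1∕4 UNMOVED; finite 𝕋⁴ at fixed ε — NOT continuum ∕ OS ∕ Clay; the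
Yang–Mills mass gap is NOT proved by any of this.

ym-nodeO-ideate ★ P3 g92 (count-neutral author seat; sketch OFFERED to ◆ CRIT-1 ∕ ▶ PTC-1 — P3 files nothing).  WHAT THIS FILE DOES, exactly.  After ✓№20 (`…K0AxJoinResidualBoxScheme`,
✓p825748) and ✓№21 (`…K0AxJoinResidualBoxSchemeNatural`, ✓p826169) the box road displays K0ᴬ ⟸ {⁸, (R-Uk), (R-Old), (R-Sch♮)}.  (R-Uk) — [15] Thm 1's existence ∕ unique-orbit clause
for the record's `U_k` — is displayed as
`∃ aU > 0, ∀ B₃ a₀ a₁, 2L² ≤ B₃ → 0 < a₀ ≤ aU → 0 < a₁ → ∃ M₀, ∀ Mc …, ∀ ε₁ ∈ ]0, a₁], B₃ε₁ ≤ a₀ → ∀ k n V, PlaqSmall ε₁ V → UkExists … a₀ V ∧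
UniqueUkOrbit … a₀ V`: ONE ceiling `aU(F)` uniform in `B₃`, for EVERY `B₃ ≥ 2L²` and EVERY `a₁ > 0`.  OBSERVATION (E), read off the kernel-checked JOIN
✓`K0AxJoinResidualBox.joinAntecedentsRadiusFirst_of_residual` (:138–:180): the JOIN consumes (R-Uk) at ONE tuple only — `hUk B₃ a₀ a₁'` where `(c, c₀, c₁, B₃, aS, a₁)` are the
letters of the PROVED V23 stub-1 text ✓`K0Stub1BHolds.prop8StepCoPGridGBAt_holds F` ([15] Prop. 8's grid-guarded top step over print's [II] (2.3) datum `lamDatum F` and print's (7) data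
`dataSmall7LamTopOf F 2`, ✓p767364's chain) and `a₁' ≤ a₁` is [6] Prop. 6's Gauge-9 letter from ✓`gauge9SupplierG3B_of_prop6MemberP` — the letters exist BEFORE the radius `a₀`
is chosen, `a₁'` after.  HENCE the door needs only
    (R-Uk⁸) := `∀ c c₀ c₁ B₃ aS a₁, 2L² ≤ B₃ → 0 < aS → 0 < a₁ → Prop8RegSepTopStepGB F 2 suppDom A‴(c,c₀,c₁) (lamDatum F) (dataSmall7LamTopOf F 2) B₃ aS a₁ →
               ∃ aU > 0, ∀ a₀ ∈ ]0, aU], ∃ M₀, ∀ Mc, McGuard → M₀ ≤ Mc → ∀ ε₁ ∈ ]0, a₁], B₃ε₁ ≤ a₀ → ∀ k n V, PlaqSmall ε₁ V →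
               UkExists … a₀ V ∧ UniqueUkOrbit … a₀ V`
— the clause demanded ONLY at letters at which [15] Prop. 8's top step HOLDS, the supplier allowed to READ that package (print's own order of proof: [15] Thm 1 is
proved FROM Props. 1–9, Prop. 8 being the top step, pp.301–304) and to let its ceiling `aU` depend on `(B₃, a₁)`.  §1 the radius-first supply from (R-Uk⁸) ∧ (R-Bg) ∧ (R-Tok)
(✓№18 §3's proof with the stub-1 letters read FIRST, (R-Uk⁸) instantiated at them, and ⁸'s antecedent (11) at `a₁'` obtained by RESTRICTION `ε₁ ≤ a₁' ≤ a₁`); §2 (R-Uk) ⟹ (R-Uk⁸)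
(the weakening is one: instantiate and forget the package; the converse is NOT claimed); §3 the doors (✓№20 §4's compositions verbatim with §1 for the JOIN):
    ★★★ K0ᴬ BY NAME ⟸ ⁸-on-the-box ∧ (R-Uk⁸) ∧ (R-Old) ∧ (R-Sch♮);   ★★★ junction `hβc` VERBATIM ⟸ cofinal ⁸ ∧ (R-Uk⁸) ∧ (R-Old) ∧ (R-Sch♮) ∧ (R-Win₁)
((R-Sch♮) = the scheme-of-record token package in its θ-free natural edition, read through ✓`residualScheme_iff_residualSchemeNatural`).
EDGE CONTENT (LENS-P3 decision table, box road, after №22): K0ᴬ ⟸ {⁸ `Sig8LR4Box`, (R-Uk⁸) = [15] Thm 1 (8)–(9)'s `U_k` clause AT THE RECORD's PROP-8 LETTERS, (R-Old), (R-Sch♮)};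
junction `hβc` ⟸ the same ∪ {cofinal ⁸, (R-Win₁)}.  (R-Uk⁸) is WEAKER than (R-Uk) (§2) — in CONTENT, not only in letters: no uniformity of the
ceiling in `B₃`, no demand at `B₃ ∕ a₁` off the proved package.  MEETING POINT (located, not used here): the stub-1 letters are the SAME letters at which the K0⁷∕N07∕N12 lane's
✓`K0TopSocketOfThm1EUText.thm1Objects_of_thm1EU_SU2` (2026-08-30) reads N12's [15] Thm 1 EU text `VariationalThm1EUSepCoP7MG F 2 A‴ B₃ ā a₁` into Thm-1 OBJECTS (a minimiser over [15] (2)'s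
class `𝔘_k(B₃ε₁)`, unique modulo `OrbitRel` over `𝔘_k(ε₀)`, `B₃ε₁ ≤ ε₀ ≤ ā`) — so the box road's (R-Uk⁸) and that lane's supplier now quantify over ONE tuple of letters; the
remaining distance between them is the class: ⁸'s antecedent (11) speaks of `IsBackground` over `bgReg … a₀` (scale-0 plaquettes, [I] (1.1)), the EU objects over [15] (2)'s all-scale class — N09's
regularity-transfer lane (✓`…N09BackgroundRadiiReg8OfThm1Objects`, ✓`…N21RegularityTransferAtRecord`), NOT claimed or typed here.

HONEST FRAMING.  CONDITIONAL doors (kernel-checked implications between DISPLAYED rows; audit `proof.conditional` ∕ support, credits nothing); NOTHING of Bałaban is asserted, ported,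
discharged or refuted; the V23 stub-1 text is CITED as the tree theorem it is (✓p767364 ∕ `K0Stub1BHolds`), not re-proved; ⁸'s box texts signed NOWHERE (⟨27930⟩ 1∕3); (R-Uk⁸) ∕ (R-Old) ∕
(R-Sch♮) ∕ (R-Win₁) are OPEN Bałaban-strength content ([15] Thm 1 (8)–(9), Props. 4, 6, 7, 9, (176)–(182); [I] (1.22), §1∕§5 + AF sign) inhabited NOWHERE as packages; K0ᴬ stmt-QuantumFields-27238
OPEN — NOTHING of it proved; K1ᴬ 27239 ∕ K3ᴬ 27247 ∕ ⟨27930⟩ OPEN; NODE O `B13TermWalkDataOneTorus.ExistsUniformAcrossSmall` NOT inhabited (0∕1); COUNT 8∕28 · K 1∕4 UNMOVED; finite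
`𝕋⁴_{L^K}` at fixed ε — NOT continuum ∕ ℝ⁴ ∕ OS; R4 = the conditional `BalabanLadder.UV` rung only; **the Yang–Mills mass gap (Clay) is NOT proved by any of this.**  No `sorry`, no `def`,
no `instance`, no `notation`; standard axioms.

References: T. Bałaban, *The variational problem and background fields in renormalization group method for lattice gauge theories*, Comm. Math. Phys. 102 (1985) 277–309
[Balaban1985Variational] — Thm 1 (8)–(9) p.279, (7) p.278, Prop. 6 p.295, Prop. 8 p.304, (147)–(163) pp.301–304, Prop. 9 p.309, (176)–(178) p.306; T. Bałaban, *Regularity and decay of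
lattice Green's functions* ∕ *Spaces of regular gauge field configurations on a lattice and gauge fixing conditions*, Comm. Math. Phys. 99 (1985) 75–102 [Balaban1985RegularSpaces] — Prop. 6
(1.130)–(1.138) p.99; T. Bałaban, *Renormalization group approach to lattice gauge field theories. I*, Comm. Math. Phys. 109 (1987) 249–301 [Balaban1987RG1] — Thm 1 p.259, Thm 2 (0.31) p.259,
Thm 3 p.264, (1.18)–(1.22) pp.263–264, (4.35)–(4.37) pp.290–291, (5.10) p.293, (5.38)–(5.44) pp.296–297; T. Bałaban, *Propagators and renormalization transformations for lattice gauge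
theories. II*, Comm. Math. Phys. 96 (1984) 223–250 [Balaban1984PropagatorsII] — (2.3) p.224.
-/

open Filter Topology
open scoped BigOperators Matrix.Norms.L2Operator
open scoped InnerProductSpace

namespace Summit.QuantumFields.YangMills.Theorems.K0AxJoinResidualBoxUk8

open Literature.MathematicalPhysics.QuantumFieldTheory.Balaban1983to89
open Literature.MathematicalPhysics.QuantumFieldTheory.Balaban1983to89.Node00
open Literature.MathematicalPhysics.QuantumFieldTheory.Balaban1983to89.T4Continuum (T4Family)
open Literature.MathematicalPhysics.QuantumFieldTheory.Balaban1983to89.B12FormatPlus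
open Literature.MathematicalPhysics.QuantumFieldTheory.Balaban1983to89.FlowStep
open Literature.MathematicalPhysics.QuantumFieldTheory.Balaban1983to89.FlowStepRuns
open B12GaugeOrbits021 (OrbitRel)
open B11Prop6Scheme (mapT)
open B11Eq103H1Complex (BondL2K SiteL2K)
open NormedSpace (exp)
open Summit.QuantumFields.YangMills.Theorems
open Summit.QuantumFields.YangMills.Theorems.K0RecordFormatNames
open Summit.QuantumFields.YangMills.Theorems.K0AxMomentRoad
open Summit.QuantumFields.YangMills.Theorems.PortHRecordJoin
open Summit.QuantumFields.YangMills.Theorems.BalabanUVNodesPortS1 (Sig8LR4Box)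
open Summit.QuantumFields.YangMills.Theorems.K0AxChartRowsOfOrbit (chartRowsBox_of_orbit)
open Summit.QuantumFields.YangMills.Theorems.K0AxJunctionWindow (Sig8LR4BoxBelow)
open Summit.QuantumFields.YangMills.Theorems.K0V23Stub3CofinalRunDoorAx (twoPrimeAx)
open Summit.QuantumFields.YangMills.BalabanUVNodes.K0Stub1BHolds (prop8StepCoPGridGBAt_holds)
open Summit.QuantumFields.YangMills.BalabanUVNodes.N07Thm1Top7FromProp8GuardedB (variationalThm1RegSepCoP7MGB_of_prop8TopStepGB_lamDatum)
open Summit.QuantumFields.YangMills.Theorems.K0PrintCubeOfStepTokensGridGuardedB (gauge9SupplierG3B_of_prop6MemberP)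
open Summit.QuantumFields.YangMills.Theorems.K0AxJoinResidualBoxScheme (residualBg_orbC_of_residualScheme)
open Summit.QuantumFields.YangMills.Theorems.K0AxJoinResidualBoxSchemeNatural (residualScheme_iff_residualSchemeNatural)

/-! ## §1  ★ The RADIUS-FIRST supply from (R-Uk⁸) ∧ (R-Bg) ∧ (R-Tok) — ✓№18 §3 with the stub-1 letters read FIRST -/

/-- ★ **THE RADIUS-FIRST SUPPLY FROM (R-Uk⁸) ∧ (R-Bg) ∧ (R-Tok)** (✓`K0AxJoinResidualBox.joinAntecedentsRadiusFirst_of_residual`'s proof REORDERED: the letters `(c, c₀, c₁, B₃, aS, a₁)` of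
the proved stub-1 text ✓`prop8StepCoPGridGBAt_holds F` are read before the radius, (R-Uk⁸) is instantiated AT THEM — yielding its ceiling `aU(B₃, a₁)` — then `a₀ := min(a, aS, aU, aB, aT)`,
[6] Prop. 6's letters `a₁' ≤ a₁`, [15] Thm 1's (7)-regularity from (8)ᴮ, and the three floors; ⁸'s antecedent (11) at `a₁'` is (R-Uk⁸)'s clause RESTRICTED to `ε₁ ≤ a₁' ≤ a₁`).
CONDITIONAL in the three receipts; nothing else asserted. [cite: Balaban1985Variational, Thm 1 (8)–(9) p.279, Prop. 6 p.295, Prop. 8 p.304, Prop. 9 p.309; Balaban1985RegularSpaces,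
Prop. 6 (1.130)–(1.138) p.99; Balaban1987RG1, (1.19) p.263, (2.3) p.265, (4.35) p.290] -/
theorem joinAntecedentsRadiusFirst_of_uk8_residual (Tok : T4Family → ℕ → ℝ → Prop) (F : T4Family)
    (hUk : ∀ (c c₀ c₁ : ℕ) (B₃ aS a₁ : ℝ), 2 * (F.L : ℝ) ^ 2 ≤ B₃ → 0 < aS → 0 < a₁ →
        Prop8RegSepTopStepGB F 2 (fun ν K Ω => suppDomOfRecord F ν K Ω)
          (fun ν M g K k _s => c ≤ ν.M₁ ∧ k + c₀ ≤ F.m + K ∧ F.L ^ c₁ ∣ M ∧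
            ∀ i, 1 ≤ i → i ≤ k → dCubeSide (F.P K).L M (RkOfRecord (F.P K).L ν.r (g i)) i ∣ (F.P K).sitesPerDir 0)
          (lamDatum F) (dataSmall7LamTopOf F 2) B₃ aS a₁ →
        ∃ aU : ℝ, 0 < aU ∧ ∀ a₀ : ℝ, 0 < a₀ → a₀ ≤ aU → ∃ M₀ : ℕ, ∀ Mc : ℕ, McGuard F Mc → M₀ ≤ Mc →
        (∀ ε₁ : ℝ, 0 < ε₁ → ε₁ ≤ a₁ → B₃ * ε₁ ≤ a₀ → ∀ (k n : ℕ) (V : GaugeField (F.P (recordK₀ F Mc k + n)) (k + 1) (SU 2)), PlaqSmall ε₁ V →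
          UkExists F 2 (recordK₀ F Mc k + n) (k + 1) a₀ V ∧ UniqueUkOrbit F 2 (recordK₀ F Mc k + n) (k + 1) a₀ V))
    (hBg : ∃ aB : ℝ, 0 < aB ∧ ∀ a₀ : ℝ, 0 < a₀ → a₀ ≤ aB → ∃ M₀ : ℕ, ∀ Mc : ℕ, McGuard F Mc → M₀ ≤ Mc →
      (∀ (k n : ℕ) (ε₂₉ : ℝ), 0 < ε₂₉ → letI θ := thetaFill F a₀ ε₂₉; letI := θ.instVβ₁; letI := θ.instVβ₂; letI := θ.instιβ;
        AnalyticAt ℝ (fun B : recordW F a₀ ε₂₉ k (recordK₀ F Mc k + n) => fun (b : PBond (F.P (recordK₀ F Mc k + n)) 0) (i i' : Fin 2) =>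
          ((recordBgField F θ k (recordK₀ F Mc k + n) B b : SU 2) : Matrix (Fin 2) (Fin 2) ℂ) i i') 0))
    (hTok : ∃ aT : ℝ, 0 < aT ∧ ∀ a₀ : ℝ, 0 < a₀ → a₀ ≤ aT → ∃ M₀ : ℕ, ∀ Mc : ℕ, McGuard F Mc → M₀ ≤ Mc → Tok F Mc a₀) :
    ∀ a : ℝ, 0 < a → ∃ a₀ : ℝ, 0 < a₀ ∧ a₀ ≤ a ∧ ∀ Mth : ℕ, ∃ Mc : ℕ, Mth ≤ Mc ∧
      ∃ (j c c₀ c₁ : ℕ) (B₃ B₃' a₁ : ℝ), JoinAntecedents Tok F Mc j c c₀ c₁ B₃ B₃' a₀ a₁ := by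
  obtain ⟨aB, haB, hBg⟩ := hBg
  obtain ⟨aT, haT, hTok⟩ := hTok
  intro a ha
  -- the stub-1 letters FIRST, then (R-Uk⁸)'s ceiling at them
  obtain ⟨c, c₀, c₁, B₃, aS, a₁, hB₃, haS, ha₁, h8⟩ := prop8StepCoPGridGBAt_holds F
  obtain ⟨aU, haU, hUk⟩ := hUk c c₀ c₁ B₃ aS a₁ hB₃ haS ha₁ h8
  have ha₀ : 0 < min (min a aS) (min aU (min aB aT)) := lt_min (lt_min ha haS) (lt_min haU (lt_min haB haT))
  have ha₀a : min (min a aS) (min aU (min aB aT)) ≤ a := (min_le_left _ _).trans (min_le_left _ _)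
  have ha₀S : min (min a aS) (min aU (min aB aT)) ≤ aS := (min_le_left _ _).trans (min_le_right _ _)
  have ha₀U : min (min a aS) (min aU (min aB aT)) ≤ aU := (min_le_right _ _).trans (min_le_left _ _)
  have ha₀B : min (min a aS) (min aU (min aB aT)) ≤ aB := (min_le_right _ _).trans ((min_le_right _ _).trans (min_le_left _ _))
  have ha₀T : min (min a aS) (min aU (min aB aT)) ≤ aT := (min_le_right _ _).trans ((min_le_right _ _).trans (min_le_right _ _))
  generalize min (min a aS) (min aU (min aB aT)) = a₀ at ha₀ ha₀a ha₀S ha₀U ha₀B ha₀T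
  have h8a := h8.of_le ha₀S le_rfl
  have hL : (0 : ℝ) < (F.L : ℝ) := by exact_mod_cast lt_trans Nat.zero_lt_one F.hL.2
  have hBpos : (0 : ℝ) < B₃ := lt_of_lt_of_le (mul_pos two_pos (pow_pos hL 2)) hB₃
  obtain ⟨j, c', B₉, a₁', hcc', hc', hc₀, hc₁, hB₉, ha₁', ha₁'le, h9⟩ :=
    gauge9SupplierG3B_of_prop6MemberP F (twoPrimeAx F) (lamDatum F) (dataSmall7LamTopOf F 2) c c₀ c₁ B₃ a₀ a₁ hB₃ ha₀ ha₁ h8a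
  have h15 : VariationalThm1RegSepCoP7MGB F 2 (fun ν M g K k _s => c' ≤ ν.M₁ ∧ k + c₀ ≤ F.m + K ∧ F.L ^ c₁ ∣ M ∧
      ∀ i, 1 ≤ i → i ≤ k → dCubeSide (F.P K).L M (RkOfRecord (F.P K).L ν.r (g i)) i ∣ (F.P K).sitesPerDir 0) (lamDatum F) (dataSmall7LamTopOf F 2) B₃ a₀ a₁' :=
    (variationalThm1RegSepCoP7MGB_of_prop8TopStepGB_lamDatum hBpos (h8a.of_le le_rfl ha₁'le)).of_imp fun _ _ _ _ _ _ h => ⟨hcc'.trans h.1, h.2⟩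
  obtain ⟨MU, hU⟩ := hUk a₀ ha₀ ha₀U
  obtain ⟨MB, hB⟩ := hBg a₀ ha₀ ha₀B
  obtain ⟨MT, hT⟩ := hTok a₀ ha₀ ha₀T
  refine ⟨a₀, ha₀, ha₀a, fun Mth => ?_⟩
  have he : ∀ n : ℕ, n ≤ max Mth (max MU (max MB MT)) → n ≤ F.L ^ max Mth (max MU (max MB MT)) :=
    fun n hn => hn.trans (Nat.lt_pow_self F.hL.2).le
  have hG : McGuard F (F.L ^ max Mth (max MU (max MB MT))) := mcGuard_pow F _
  refine ⟨F.L ^ max Mth (max MU (max MB MT)), he Mth (le_max_left _ _), j, c', c₀, c₁, B₃, B₉, a₁', ?_⟩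
  unfold JoinAntecedents
  exact ⟨hG, hc', hc₀, hc₁, hB₃, hB₉, ha₀, ha₁', h15, h9,
    fun ε₁ hε₁ hε₁a hBε => hU _ hG (he MU ((le_max_left _ _).trans (le_max_right _ _))) ε₁ hε₁ (hε₁a.trans ha₁'le) hBε,
    hB _ hG (he MB (((le_max_left _ _).trans (le_max_right _ _)).trans (le_max_right _ _))),
    hT _ hG (he MT (((le_max_right _ _).trans (le_max_right _ _)).trans (le_max_right _ _)))⟩

/-! ## §2  (R-Uk) ⟹ (R-Uk⁸): the re-cut IS a weakening (instantiate `B₃, a₁`, forget the package; the ceiling stays uniform) — the converse is NOT claimed -/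

/-- **(R-Uk) ⟹ (R-Uk⁸), AT ONE FAMILY** (bookkeeping: ✓№18∕№20's displayed (R-Uk) instantiated at the stub-1 letters, the Prop-8 package unused).  Records that §3's doors are WEAKER-keyed than
✓№20 §4's; nothing asserted. [cite: Balaban1985Variational, Thm 1 (8)–(9) p.279, Prop. 8 p.304 (bookkeeping)] -/
theorem residualUk8_of_residualUk (F : T4Family)
    (hUk : ∃ aU : ℝ, 0 < aU ∧ ∀ (B₃ a₀ a₁ : ℝ), 2 * (F.L : ℝ) ^ 2 ≤ B₃ → 0 < a₀ → a₀ ≤ aU → 0 < a₁ → ∃ M₀ : ℕ, ∀ Mc : ℕ, McGuard F Mc → M₀ ≤ Mc →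
      (∀ ε₁ : ℝ, 0 < ε₁ → ε₁ ≤ a₁ → B₃ * ε₁ ≤ a₀ → ∀ (k n : ℕ) (V : GaugeField (F.P (recordK₀ F Mc k + n)) (k + 1) (SU 2)), PlaqSmall ε₁ V →
        UkExists F 2 (recordK₀ F Mc k + n) (k + 1) a₀ V ∧ UniqueUkOrbit F 2 (recordK₀ F Mc k + n) (k + 1) a₀ V)) :
    ∀ (c c₀ c₁ : ℕ) (B₃ aS a₁ : ℝ), 2 * (F.L : ℝ) ^ 2 ≤ B₃ → 0 < aS → 0 < a₁ →
        Prop8RegSepTopStepGB F 2 (fun ν K Ω => suppDomOfRecord F ν K Ω)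
          (fun ν M g K k _s => c ≤ ν.M₁ ∧ k + c₀ ≤ F.m + K ∧ F.L ^ c₁ ∣ M ∧
            ∀ i, 1 ≤ i → i ≤ k → dCubeSide (F.P K).L M (RkOfRecord (F.P K).L ν.r (g i)) i ∣ (F.P K).sitesPerDir 0)
          (lamDatum F) (dataSmall7LamTopOf F 2) B₃ aS a₁ →
        ∃ aU : ℝ, 0 < aU ∧ ∀ a₀ : ℝ, 0 < a₀ → a₀ ≤ aU → ∃ M₀ : ℕ, ∀ Mc : ℕ, McGuard F Mc → M₀ ≤ Mc →
        (∀ ε₁ : ℝ, 0 < ε₁ → ε₁ ≤ a₁ → B₃ * ε₁ ≤ a₀ → ∀ (k n : ℕ) (V : GaugeField (F.P (recordK₀ F Mc k + n)) (k + 1) (SU 2)), PlaqSmall ε₁ V →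
          UkExists F 2 (recordK₀ F Mc k + n) (k + 1) a₀ V ∧ UniqueUkOrbit F 2 (recordK₀ F Mc k + n) (k + 1) a₀ V) := by
  obtain ⟨aU, haU, h⟩ := hUk
  exact fun c c₀ c₁ B₃ aS a₁ hB₃ _ ha₁ _ => ⟨aU, haU, fun a₀ ha₀ hle => h B₃ a₀ a₁ hB₃ ha₀ hle ha₁⟩

/-! ## §3  ★★★ THE DOORS RE-CUT ON (R-Uk⁸): K0ᴬ ⟸ ⁸-box ∧ (R-Uk⁸) ∧ (R-Old) ∧ (R-Sch♮);  junction `hβc` ⟸ cofinal ⁸ ∧ (R-Uk⁸) ∧ (R-Old) ∧ (R-Sch♮) ∧ (R-Win₁) -/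

/-- ★★★ **K0ᴬ BY NAME ⟸ ⁸-ON-THE-BOX ∧ (R-Uk⁸) ∧ (R-Old) ∧ (R-Sch♮)** (✓`K0AxJoinResidualBoxScheme.record13SepCoPHInhabitedAx_of_sig8LR4Box_uk_old_scheme`'s composition verbatim
with §1 for the JOIN, the scheme receipt in its θ-free natural edition via ✓`residualScheme_iff_residualSchemeNatural`): (R-Sch♮) ⟹ (R-Sch) ⟹ (R-Bg) ∧ (R-Orb)
(✓`residualBg_orbC_of_residualScheme`); radius `a₀ ≤ min a aO` from §1 at `Tok := TokP9L4Old`; ⁸ at the JOIN's letters; rows ✓`chartRowsBox_of_orbit`;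
✓`record13SepCoPHInhabitedAx_of_chartRowsBox_cofinalRadii` at level `min γ₀ ½`, `Mg := 4·Mc`.  (R-Uk⁸) = [15] Thm 1 (8)–(9)'s existence ∕ unique-orbit clause for the record's `U_k`, demanded
ONLY at grid letters and constants `(c, c₀, c₁, B₃, aS, a₁)` at which [15] Prop. 8's grid-guarded top step over print's datum HOLDS (the supplier may read that package; its ceiling may depend
on them).  CONDITIONAL helper; every displayed hypothesis OPEN Bałaban-strength content inhabited NOWHERE; K0ᴬ 27238 OPEN; nothing of Bałaban discharged; the Yang–Mills mass gap is NOT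
proved. [cite: Balaban1985Variational, Thm 1 (8)–(9) p.279, (7) p.278, Prop. 6 p.295, Prop. 8 p.304, Prop. 9 p.309, (176)–(178) p.306; Balaban1987RG1, Thm 1 p.259, Thm 3 p.264, (1.18)–(1.22)
pp.263–264, (4.35)–(4.37) pp.290–291, (5.10) p.293; Balaban1984PropagatorsII, (2.3) p.224] -/
theorem record13SepCoPHInhabitedAx_of_sig8LR4Box_uk8_old_schemeNatural
    (h8 : ∀ F, Sig8LR4Box F)
    (hUk : ∀ F : T4Family,
      ∀ (c c₀ c₁ : ℕ) (B₃ aS a₁ : ℝ), 2 * (F.L : ℝ) ^ 2 ≤ B₃ → 0 < aS → 0 < a₁ →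
        Prop8RegSepTopStepGB F 2 (fun ν K Ω => suppDomOfRecord F ν K Ω)
          (fun ν M g K k _s => c ≤ ν.M₁ ∧ k + c₀ ≤ F.m + K ∧ F.L ^ c₁ ∣ M ∧
            ∀ i, 1 ≤ i → i ≤ k → dCubeSide (F.P K).L M (RkOfRecord (F.P K).L ν.r (g i)) i ∣ (F.P K).sitesPerDir 0)
          (lamDatum F) (dataSmall7LamTopOf F 2) B₃ aS a₁ →
        ∃ aU : ℝ, 0 < aU ∧ ∀ a₀ : ℝ, 0 < a₀ → a₀ ≤ aU → ∃ M₀ : ℕ, ∀ Mc : ℕ, McGuard F Mc → M₀ ≤ Mc →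
        (∀ ε₁ : ℝ, 0 < ε₁ → ε₁ ≤ a₁ → B₃ * ε₁ ≤ a₀ → ∀ (k n : ℕ) (V : GaugeField (F.P (recordK₀ F Mc k + n)) (k + 1) (SU 2)), PlaqSmall ε₁ V →
          UkExists F 2 (recordK₀ F Mc k + n) (k + 1) a₀ V ∧ UniqueUkOrbit F 2 (recordK₀ F Mc k + n) (k + 1) a₀ V))
    (hOld : ∀ F : T4Family,
      ∃ aT : ℝ, 0 < aT ∧ ∀ a₀ : ℝ, 0 < a₀ → a₀ ≤ aT → ∃ M₀ : ℕ, ∀ Mc : ℕ, McGuard F Mc → M₀ ≤ Mc → TokP9L4Old F Mc a₀)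
    (hSch : ∀ F : T4Family,
      ∃ aS : ℝ, 0 < aS ∧ ∀ a₀ : ℝ, 0 < a₀ → a₀ ≤ aS → ∃ M₀ : ℕ, ∀ Mc : ℕ, McGuard F Mc → M₀ ≤ Mc → ∀ k n : ℕ,
        haveI := factL F; haveI := factEta F (recordK₀ F Mc k + n) (k + 1); haveI := factC0 F (recordK₀ F Mc k + n) (k + 1); haveI := wBRec_fact F (recordK₀ F Mc k + n) (k + 1);
        ∃ (Ω : ℕ → Set (Site (F.P (recordK₀ F Mc k + n)) 0)) (dom : Set (GaugeField (F.P (recordK₀ F Mc k + n)) (k + 1) (SU 2))) (levB : PBond (F.P (recordK₀ F Mc k + n)) (k + 1) → ℕ)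
          (Gp : SiteL2K ℂ (F.P (recordK₀ F Mc k + n)).d (fun _ => (F.P (recordK₀ F Mc k + n)).sitesPerDir 0) (c0Rec F (recordK₀ F Mc k + n) (k + 1)) (WRec 2) →ₗ[ℂ]
            SiteL2K ℂ (F.P (recordK₀ F Mc k + n)).d (fun _ => (F.P (recordK₀ F Mc k + n)).sitesPerDir 0) (c0Rec F (recordK₀ F Mc k + n) (k + 1)) (WRec 2))
          (Δ2 : BondL2K ℂ (F.P (recordK₀ F Mc k + n)).d (fun _ => (F.P (recordK₀ F Mc k + n)).sitesPerDir 0) (c0Rec F (recordK₀ F Mc k + n) (k + 1)) (WRec 2) →ₗ[ℂ]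
            BondL2K ℂ (F.P (recordK₀ F Mc k + n)).d (fun _ => (F.P (recordK₀ F Mc k + n)).sitesPerDir 0) (c0Rec F (recordK₀ F Mc k + n) (k + 1)) (WRec 2)) (a : ℝ)
          (hposπ : ∀ x, x ≠ 0 → 0 < RCLike.re ⟪x, laplaceAOfRecordAt F 2 (k + 1) (1 : GaugeField (F.P (recordK₀ F Mc k + n)) 0 (SU 2))
            (hessOpOfRecord128 F 2 (k + 1) (1 : GaugeField (F.P (recordK₀ F Mc k + n)) 0 (SU 2)) Gp (QflatOfRecord F 2 (k + 1)) Δ2)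
            (QOfRecord F 2 (k + 1) (1 : GaugeField (F.P (recordK₀ F Mc k + n)) 0 (SU 2))) (QflatOfRecord F 2 (k + 1)) a x⟫_ℂ)
          (hposb : ∀ x, x ≠ 0 → 0 < RCLike.re ⟪x, laplaceAOfRecord F 2 (k + 1) (1 : GaugeField (F.P (recordK₀ F Mc k + n)) 0 (SU 2))
            (QOfRecord F 2 (k + 1) (1 : GaugeField (F.P (recordK₀ F Mc k + n)) 0 (SU 2))) (QflatOfRecord F 2 (k + 1)) a x⟫_ℂ)
          (hQ : Function.Surjective (QOfRecord F 2 (k + 1) (1 : GaugeField (F.P (recordK₀ F Mc k + n)) 0 (SU 2)))) (εC B₀ C₄ a₃ j a𝔄 ε₄ : ℝ)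
          (S : BgSchemeOnLit F 2 (recordK₀ F Mc k + n) (k + 1) Ω 1)
          (_ : S = bgSchemeOfRecord F 2 (recordK₀ F Mc k + n) (k + 1) Ω 1 dom levB Gp Δ2 a hposπ hposb hQ εC B₀ C₄ a₃ j a𝔄 ε₄)
          (Kc : GaugeField (F.P (recordK₀ F Mc k + n)) (k + 1) (SU 2) → Set (Space115Lit F 2 (recordK₀ F Mc k + n) (k + 1) Ω 1)),
          S.RegimeTok ∧ WAnalyticTok F 2 (recordK₀ F Mc k + n) (k + 1) Ω 1 levB Gp a hposb hQ εC a₃ ∧ 0 < a𝔄 ∧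
          dom ∈ 𝓝 (1 : GaugeField (F.P (recordK₀ F Mc k + n)) (k + 1) (SU 2)) ∧
          (∀ V ∈ S.dom, ∀ A ∈ Kc V, S.chart V A ∈ bgReg F 2 (recordK₀ F Mc k + n) (k + 1) a₀ ∧ Averaging.iter (avOfRecord F 2 (recordK₀ F Mc k + n)) (k + 1) (S.chart V A) = V) ∧
          (∀ V ∈ S.dom, ∀ U : GaugeField (F.P (recordK₀ F Mc k + n)) 0 (SU 2), U ∈ bgReg F 2 (recordK₀ F Mc k + n) (k + 1) a₀ →
            Averaging.iter (avOfRecord F 2 (recordK₀ F Mc k + n)) (k + 1) U = V → ∃ A ∈ Kc V, OrbitRel (k + 1) (S.chart V A) U) ∧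
          (∀ V ∈ S.dom, ∀ A ∈ Kc V, IsMinOn (wilsonAction4 ∘ S.chart V) (Kc V) A →
            ‖A‖ ≤ S.ε₄ ∧ mapT (S.𝒢 V) 0 (S.W V) (S.J V) (S.𝔄 V) A = A) ∧
          (∀ V ∈ S.dom, S.sol V ∈ Kc V) ∧ (∀ V ∈ S.dom, IsMinOn (wilsonAction4 ∘ S.chart V) (Kc V) (S.sol V)) ∧
          (∀ᶠ B in 𝓝 (0 : Fin (F.P (recordK₀ F Mc k + n)).d → Site (F.P (recordK₀ F Mc k + n)) (k + 1) → Fin (suChartDim 2) → ℝ),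
            S.LieTokAt (readField F 2 (suOfMat 2) fun μ x => exp (suChartMap 2 (B μ x))))) :
    Summit.QuantumFields.YangMills.Theses.BalabanUVNodes.Record13SepCoPHInhabitedAx := by
  refine record13SepCoPHInhabitedAx_of_chartRowsBox_cofinalRadii fun F a ha => ?_
  obtain ⟨Mth, h8F⟩ := h8 F
  obtain ⟨hBg, aO, haO, hO⟩ := residualBg_orbC_of_residualScheme F ((residualScheme_iff_residualSchemeNatural F).2 (hSch F))
  obtain ⟨a₀, ha₀', hle, hAM⟩ := joinAntecedentsRadiusFirst_of_uk8_residual TokP9L4Old F (hUk F) hBg (hOld F) (min a aO) (lt_min ha haO)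
  obtain ⟨MO, hMO⟩ := hO a₀ ha₀' (hle.trans (min_le_right _ _))
  obtain ⟨Mc, hMc, j, c, c₀, c₁, B₃, B₃', a₁, hAnt⟩ := hAM (max Mth MO)
  obtain ⟨hG0, hc, hc₀, hc₁, hB₃, hB₃', ha₀, ha₁, hThm, hGauge, hUk', hBg', hP9⟩ := hAnt
  obtain ⟨γ₀, ε₂₉, E₀, κ, α₀, α₁, hγ₀, hε, hE₀, hκ, hα₀, hα₁, hD⟩ :=
    h8F Mc ((le_max_left _ _).trans hMc) j c c₀ c₁ B₃ B₃' a₀ a₁ hG0 hc hc₀ hc₁ hB₃ hB₃' ha₀ ha₁ hThm hGauge hUk' hBg' hP9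
  letI θ := thetaFill F a₀ ε₂₉; letI := θ.instVβ₁; letI := θ.instVβ₂; letI := θ.instιβ
  obtain ⟨ιC, hsw, h9⟩ :=
    chartRowsBox_of_orbit F Mc a₀ ε₂₉ ha₀ (hMO Mc hG0 ((le_max_right _ _).trans hMc) ε₂₉ hε) fun k n => (hBg' k n ε₂₉ hε).contDiffAt
  refine ⟨a₀, ha₀, hle.trans (min_le_left _ _), min γ₀ (1 / 2), ε₂₉, E₀, κ, 4 * (Mc : ℝ), α₀, α₁, Mc, lt_min hγ₀ (by norm_num), min_le_right _ _, hε,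
    hE₀, hκ, hα₀, hα₁, hG0, le_rfl, ιC, fun k v hv => hD k v ?_, hsw, h9⟩
  exact mem_box.mpr fun i => ⟨(mem_box.mp hv i).1, (mem_box.mp hv i).2.trans (min_le_left _ _)⟩

/-- ★★★ **THE JUNCTION's BINDER `hβc` VERBATIM ⟸ cofinal ⁸ ∧ (R-Uk⁸) ∧ (R-Old) ∧ (R-Sch♮) ∧ (R-Win₁)**
(✓`K0AxJoinResidualBoxScheme.cofinalBetaSocketAxBody_allRadii_of_sig8LR4BoxCofinal_uk_old_scheme_winC`'s order of reading verbatim with §1 for the JOIN): radius `a₀ ≤ min a (min aO aW)`;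
window `(εw, γw)` at `a₀`; ⁸-below at `εw` → `Mth`; (R-Sch♮)'s orbit floor at `a₀`; supply at `max Mth M₀` → `Mc`, the thirteen antecedents; ⁸ at the JOIN's letters →
`ε₂₉ ≤ εw`, `γ₀`; rows ✓`chartRowsBox_of_orbit` + antecedent (12); the two letters restricted to `min γ₀ γw` (`ContinuousOn.mono` ∘ ✓`box_mono`);
✓`cofinalBetaSocketAxBody_of_chartRowsBox_hessBox_negPart` at `a₀ ≤ a`, level `min γ₀ γw ≤ ½`, `Mg := 4·Mc`.  CONDITIONAL; every hypothesis OPEN Bałaban-strength content inhabited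
NOWHERE; the junction's consumer, K0ᴬ 27238, K1ᴬ 27239 remain OPEN; NODE O 0∕1; the Yang–Mills mass gap is NOT proved.
[cite: Balaban1987RG1, Thm 2 (0.31) p.259, Thm 3 p.264, (1.18)–(1.22) pp.263–264, (4.35) p.290, (5.38)–(5.44) pp.296–297; Balaban1985Variational, Thm 1 (8)–(9) p.279, Prop. 6 p.295,
Prop. 8 p.304, Prop. 9 p.309, (176)–(178) p.306] -/
theorem cofinalBetaSocketAxBody_allRadii_of_sig8LR4BoxCofinal_uk8_old_schemeNatural_winC
    (h8c : ∀ (F : T4Family) (εw : ℝ), 0 < εw → Sig8LR4BoxBelow F εw)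
    (hUk : ∀ F : T4Family,
      ∀ (c c₀ c₁ : ℕ) (B₃ aS a₁ : ℝ), 2 * (F.L : ℝ) ^ 2 ≤ B₃ → 0 < aS → 0 < a₁ →
        Prop8RegSepTopStepGB F 2 (fun ν K Ω => suppDomOfRecord F ν K Ω)
          (fun ν M g K k _s => c ≤ ν.M₁ ∧ k + c₀ ≤ F.m + K ∧ F.L ^ c₁ ∣ M ∧
            ∀ i, 1 ≤ i → i ≤ k → dCubeSide (F.P K).L M (RkOfRecord (F.P K).L ν.r (g i)) i ∣ (F.P K).sitesPerDir 0)
          (lamDatum F) (dataSmall7LamTopOf F 2) B₃ aS a₁ →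
        ∃ aU : ℝ, 0 < aU ∧ ∀ a₀ : ℝ, 0 < a₀ → a₀ ≤ aU → ∃ M₀ : ℕ, ∀ Mc : ℕ, McGuard F Mc → M₀ ≤ Mc →
        (∀ ε₁ : ℝ, 0 < ε₁ → ε₁ ≤ a₁ → B₃ * ε₁ ≤ a₀ → ∀ (k n : ℕ) (V : GaugeField (F.P (recordK₀ F Mc k + n)) (k + 1) (SU 2)), PlaqSmall ε₁ V →
          UkExists F 2 (recordK₀ F Mc k + n) (k + 1) a₀ V ∧ UniqueUkOrbit F 2 (recordK₀ F Mc k + n) (k + 1) a₀ V))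
    (hOld : ∀ F : T4Family,
      ∃ aT : ℝ, 0 < aT ∧ ∀ a₀ : ℝ, 0 < a₀ → a₀ ≤ aT → ∃ M₀ : ℕ, ∀ Mc : ℕ, McGuard F Mc → M₀ ≤ Mc → TokP9L4Old F Mc a₀)
    (hSch : ∀ F : T4Family,
      ∃ aS : ℝ, 0 < aS ∧ ∀ a₀ : ℝ, 0 < a₀ → a₀ ≤ aS → ∃ M₀ : ℕ, ∀ Mc : ℕ, McGuard F Mc → M₀ ≤ Mc → ∀ k n : ℕ,
        haveI := factL F; haveI := factEta F (recordK₀ F Mc k + n) (k + 1); haveI := factC0 F (recordK₀ F Mc k + n) (k + 1); haveI := wBRec_fact F (recordK₀ F Mc k + n) (k + 1);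
        ∃ (Ω : ℕ → Set (Site (F.P (recordK₀ F Mc k + n)) 0)) (dom : Set (GaugeField (F.P (recordK₀ F Mc k + n)) (k + 1) (SU 2))) (levB : PBond (F.P (recordK₀ F Mc k + n)) (k + 1) → ℕ)
          (Gp : SiteL2K ℂ (F.P (recordK₀ F Mc k + n)).d (fun _ => (F.P (recordK₀ F Mc k + n)).sitesPerDir 0) (c0Rec F (recordK₀ F Mc k + n) (k + 1)) (WRec 2) →ₗ[ℂ]
            SiteL2K ℂ (F.P (recordK₀ F Mc k + n)).d (fun _ => (F.P (recordK₀ F Mc k + n)).sitesPerDir 0) (c0Rec F (recordK₀ F Mc k + n) (k + 1)) (WRec 2))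
          (Δ2 : BondL2K ℂ (F.P (recordK₀ F Mc k + n)).d (fun _ => (F.P (recordK₀ F Mc k + n)).sitesPerDir 0) (c0Rec F (recordK₀ F Mc k + n) (k + 1)) (WRec 2) →ₗ[ℂ]
            BondL2K ℂ (F.P (recordK₀ F Mc k + n)).d (fun _ => (F.P (recordK₀ F Mc k + n)).sitesPerDir 0) (c0Rec F (recordK₀ F Mc k + n) (k + 1)) (WRec 2)) (a : ℝ)
          (hposπ : ∀ x, x ≠ 0 → 0 < RCLike.re ⟪x, laplaceAOfRecordAt F 2 (k + 1) (1 : GaugeField (F.P (recordK₀ F Mc k + n)) 0 (SU 2))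
            (hessOpOfRecord128 F 2 (k + 1) (1 : GaugeField (F.P (recordK₀ F Mc k + n)) 0 (SU 2)) Gp (QflatOfRecord F 2 (k + 1)) Δ2)
            (QOfRecord F 2 (k + 1) (1 : GaugeField (F.P (recordK₀ F Mc k + n)) 0 (SU 2))) (QflatOfRecord F 2 (k + 1)) a x⟫_ℂ)
          (hposb : ∀ x, x ≠ 0 → 0 < RCLike.re ⟪x, laplaceAOfRecord F 2 (k + 1) (1 : GaugeField (F.P (recordK₀ F Mc k + n)) 0 (SU 2))
            (QOfRecord F 2 (k + 1) (1 : GaugeField (F.P (recordK₀ F Mc k + n)) 0 (SU 2))) (QflatOfRecord F 2 (k + 1)) a x⟫_ℂ)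
          (hQ : Function.Surjective (QOfRecord F 2 (k + 1) (1 : GaugeField (F.P (recordK₀ F Mc k + n)) 0 (SU 2)))) (εC B₀ C₄ a₃ j a𝔄 ε₄ : ℝ)
          (S : BgSchemeOnLit F 2 (recordK₀ F Mc k + n) (k + 1) Ω 1)
          (_ : S = bgSchemeOfRecord F 2 (recordK₀ F Mc k + n) (k + 1) Ω 1 dom levB Gp Δ2 a hposπ hposb hQ εC B₀ C₄ a₃ j a𝔄 ε₄)
          (Kc : GaugeField (F.P (recordK₀ F Mc k + n)) (k + 1) (SU 2) → Set (Space115Lit F 2 (recordK₀ F Mc k + n) (k + 1) Ω 1)),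
          S.RegimeTok ∧ WAnalyticTok F 2 (recordK₀ F Mc k + n) (k + 1) Ω 1 levB Gp a hposb hQ εC a₃ ∧ 0 < a𝔄 ∧
          dom ∈ 𝓝 (1 : GaugeField (F.P (recordK₀ F Mc k + n)) (k + 1) (SU 2)) ∧
          (∀ V ∈ S.dom, ∀ A ∈ Kc V, S.chart V A ∈ bgReg F 2 (recordK₀ F Mc k + n) (k + 1) a₀ ∧ Averaging.iter (avOfRecord F 2 (recordK₀ F Mc k + n)) (k + 1) (S.chart V A) = V) ∧
          (∀ V ∈ S.dom, ∀ U : GaugeField (F.P (recordK₀ F Mc k + n)) 0 (SU 2), U ∈ bgReg F 2 (recordK₀ F Mc k + n) (k + 1) a₀ →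
            Averaging.iter (avOfRecord F 2 (recordK₀ F Mc k + n)) (k + 1) U = V → ∃ A ∈ Kc V, OrbitRel (k + 1) (S.chart V A) U) ∧
          (∀ V ∈ S.dom, ∀ A ∈ Kc V, IsMinOn (wilsonAction4 ∘ S.chart V) (Kc V) A →
            ‖A‖ ≤ S.ε₄ ∧ mapT (S.𝒢 V) 0 (S.W V) (S.J V) (S.𝔄 V) A = A) ∧
          (∀ V ∈ S.dom, S.sol V ∈ Kc V) ∧ (∀ V ∈ S.dom, IsMinOn (wilsonAction4 ∘ S.chart V) (Kc V) (S.sol V)) ∧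
          (∀ᶠ B in 𝓝 (0 : Fin (F.P (recordK₀ F Mc k + n)).d → Site (F.P (recordK₀ F Mc k + n)) (k + 1) → Fin (suChartDim 2) → ℝ),
            S.LieTokAt (readField F 2 (suOfMat 2) fun μ x => exp (suChartMap 2 (B μ x)))))
    (hWinC : ∀ F : T4Family,
      ∃ aW : ℝ, 0 < aW ∧ ∀ a₀ : ℝ, 0 < a₀ → a₀ ≤ aW → ∃ εw γw : ℝ, 0 < εw ∧ 0 < γw ∧ γw ≤ 1 / 2 ∧ ∀ ε₂₉ : ℝ, 0 < ε₂₉ → ε₂₉ ≤ εw →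
        (letI θ := thetaFill F a₀ ε₂₉; letI := θ.instVβ₁; letI := θ.instVβ₂; letI := θ.instιβ;
         (∀ k K : ℕ, ContinuousOn (fun v : Fin (k + 1) → ℝ => fderiv ℝ (fderiv ℝ (B12PolarizationTensor120.expChart (recordTermsAx F a₀ ε₂₉ k v K) θ.ρ8)) 0) (FlowStep.Box γw k))) ∧
         ∃ e : ℕ → ℝ, RecordPlimMomentNegPartOnBoxAx F a₀ ε₂₉ γw e) :
    ∀ F : T4Family, ∀ a : ℝ, 0 < a → CofinalBetaSocketAxBody F a := by
  intro F a ha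
  obtain ⟨hBg, aO, haO, hO⟩ := residualBg_orbC_of_residualScheme F ((residualScheme_iff_residualSchemeNatural F).2 (hSch F))
  obtain ⟨aW, haW, hWa⟩ := hWinC F
  obtain ⟨a₀, ha₀', hle, hAM⟩ :=
    joinAntecedentsRadiusFirst_of_uk8_residual TokP9L4Old F (hUk F) hBg (hOld F) (min a (min aO aW)) (lt_min ha (lt_min haO haW))
  have hleA : a₀ ≤ a := hle.trans (min_le_left _ _)
  have hleO : a₀ ≤ aO := hle.trans ((min_le_right _ _).trans (min_le_left _ _))
  have hleW : a₀ ≤ aW := hle.trans ((min_le_right _ _).trans (min_le_right _ _))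
  obtain ⟨εw, γw, hεw, hγw, hγh, hW⟩ := hWa a₀ ha₀' hleW
  obtain ⟨Mth, h8F⟩ := h8c F εw hεw
  obtain ⟨MO, hMO⟩ := hO a₀ ha₀' hleO
  obtain ⟨Mc, hMc, j, c, c₀, c₁, B₃, B₃', a₁, hAnt⟩ := hAM (max Mth MO)
  obtain ⟨hG0, hc, hc₀, hc₁, hB₃, hB₃', ha₀, ha₁, hThm, hGauge, hUk', hBg', hP9⟩ := hAnt
  obtain ⟨γ₀, ε₂₉, E₀, κ, α₀, α₁, hγ₀, hε, hεle, hE₀, hκ, hα₀, hα₁, hD⟩ :=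
    h8F Mc ((le_max_left _ _).trans hMc) j c c₀ c₁ B₃ B₃' a₀ a₁ hG0 hc hc₀ hc₁ hB₃ hB₃' ha₀ ha₁ hThm hGauge hUk' hBg' hP9
  letI θ := thetaFill F a₀ ε₂₉; letI := θ.instVβ₁; letI := θ.instVβ₂; letI := θ.instιβ
  obtain ⟨ιC, hsw, h9⟩ :=
    chartRowsBox_of_orbit F Mc a₀ ε₂₉ ha₀ (hMO Mc hG0 ((le_max_right _ _).trans hMc) ε₂₉ hε) fun k n => (hBg' k n ε₂₉ hε).contDiffAt
  obtain ⟨hH, e, hN⟩ := hW ε₂₉ hε hεle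
  -- ⁸'s level and the window's single level, met at `min γ₀ γw`
  have hγ₁ : 0 < min γ₀ γw := lt_min hγ₀ hγw
  have hγh' : min γ₀ γw ≤ 1 / 2 := (min_le_right _ _).trans hγh
  have hN' : RecordPlimMomentNegPartOnBoxAx F a₀ ε₂₉ (min γ₀ γw) e :=
    ⟨hN.1, hN.2.1, fun k v hv => hN.2.2 k v (box_mono (min_le_right _ _) k hv)⟩
  refine cofinalBetaSocketAxBody_of_chartRowsBox_hessBox_negPart (Mg := 4 * (Mc : ℝ)) hE₀ hκ F a₀ ε₂₉ (min γ₀ γw) α₀ α₁ ha₀ hleA hγ₁ hγh' hε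
    hα₀ hα₁ Mc hG0 le_rfl ιC (fun k v hv => hD k v ?_) hsw h9 (fun k K => (hH k K).mono (box_mono (min_le_right _ _) k)) hN'
  exact mem_box.mpr fun i => ⟨(mem_box.mp hv i).1, (mem_box.mp hv i).2.trans (min_le_left _ _)⟩

-- standard axioms only
#print axioms joinAntecedentsRadiusFirst_of_uk8_residual
#print axioms residualUk8_of_residualUk
#print axioms record13SepCoPHInhabitedAx_of_sig8LR4Box_uk8_old_schemeNatural
#print axioms cofinalBetaSocketAxBody_allRadii_of_sig8LR4BoxCofinal_uk8_old_schemeNatural_winC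

end Summit.QuantumFields.YangMills.Theorems.K0AxJoinResidualBoxUk8
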